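import Mathlib
import Literature.MathematicalPhysics.QuantumFieldTheory.Balaban1983to89.B5Prop11Lattice

/-!
# B5 Sect. C and Prop. 1.1 for REAL vector fields, as printed — reality of every typed lattice
# operator of the chain, the real matrices `Δ_a`, `G = Δ_a⁻¹`, and the packaging of `G`, `Δ_a`
# as symmetric endomorphisms of the real Euclidean space of vector fields on `T_η`

Source: T. Bałaban, *Propagators and renormalization transformations for lattice gauge
theories. I*, Commun. Math. Phys. 95 (1984) 17–40 (`Balaban1984PropagatorsI`, "B5"), renders
`b2b-balaban-ref1/pages/1984-cmp95-propagators-rt-I/…-p002-x2.png` (journal p. 18; read as image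
this session), `…-p014-x2.png` (p. 30) and `…-p017-x2.png` (p. 33), read as images in this lineage.

WHAT IS PRINTED. B5 works with real-valued configurations: p. 18 «Thus A are functions
A : {b ⊂ T_ε} → ℝ. We identify them with vector valued functions defined on T_ε by the formula
A_{⟨x,x+εe_μ⟩} = A(x, x + εe_μ) = A_μ(x), x ∈ T_ε, μ = 1, …, d. (1.1)», «We assume that A_b is
defined for bonds b with arbitrary orientation and that A_{⟨x,x′⟩} = −A_{⟨x′,x⟩}.» and «A guage
transformation is determined by a real valued function λ : T_ε → ℝ» (sic; render
`…-p002-x2.png`, read as image this session); p. 30 (1.71) «Δ_a⁻¹ = G_k, or simply G» and (1.73) «has a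
unique solution for the arbitrary vector function J»; p. 33: «Proposition 1.1. The operator G
is a symmetric operator on L²(T_η) and ‖GJ‖, ‖∇GJ‖, ‖G∇*J‖, ‖∇G∇*J‖, ‖∇∇GJ‖, ‖G∇*∇*J‖ ≤
γ₀⁻¹‖J‖, (1.89) with a positive constant γ₀ independent of k, T_η, and depending on d only (if
we put a = 1). This implies the bound from below: Δ_a = G⁻¹ ≥ γ₀(Δ + I). (1.90)» (transcribed
in pass 27, `B5Prop11Lattice`).

WHAT THE CHAIN TYPED SO FAR. Passes 2–27 of this node typed every operator of Sect. C as a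
COMPLEX matrix (`Matrix _ _ ℂ`, fields `T_η × {1..d} → ℂ`), because the Fourier analysis of
(1.29)–(1.36) lives over `ℂ`; this was recorded as reading (v) of DIVERGENCE D-pv15g3.2
("real fields -> complex fields"). The present module closes that divergence:

* §1 a predicate `IsReal A` (all entries real: `conj (A i j) = A i j`) with its closure under
  `+`, `−`, scalar multiplication by reals, products, sums, `ᴴ`, `ᵀ` and matrix inverse;
* §2 EVERY typed operator of the chain is real: the shifts and differences `shiftM`, `fdiff`,
  `shiftS`, `sdiff` (real lattice factor), `GradOp`, `Lap`, `LapS`, the block averages `QsOp`,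
  `QvOp`, `QvAdj`, `Cavg`, the Fourier-multiplier operators `Δ⁻¹ = LapSinv` and `Pker` (a DFT
  sandwich `U* diag(m) U` with a real EVEN multiplier is real, since `conj U_{p,x} = U_{−p,x}`),
  hence `Mop = Q′Δ⁻²Q′*`, `Kmat`, `Minv = (Q′Δ⁻²Q′*)⁻¹`, the projection `P = PcT`, and finally
  `Δ_a = DeltaA` and `G = Δ_a⁻¹`;
* §3 the REAL matrices `DeltaAR := re ∘ Δ_a`, `GR := re ∘ Δ_a⁻¹` (entrywise real parts), with
  `DeltaAR.map (↑) = Δ_a`, `GR.map (↑) = Δ_a⁻¹`, `Δ_a G = G Δ_a = 1` over `ℝ`, `GR = DeltaAR⁻¹`,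
  both symmetric, `Δ_a` and `G` positive definite over `ℝ`, and Prop. 1.1 transferred to REAL
  vector / tensor fields with the same constant `γ₀ = gammaZero d a` of pass 27: the six bounds of
  (1.89) for real `J` and (1.90) both as a real quadratic-form inequality and in the Löwner order
  of real symmetric matrices;
* §4 the packaging used downstream (the `Realisation` interface of `B5Local114`): on the real
  inner-product space `V = EuclideanSpace ℝ (T_η × {1..d})`, `GEnd`, `DeltaAEnd : Module.End ℝ V`
  with `DeltaAEnd * GEnd = 1`, `GEnd * DeltaAEnd = 1` ((1.71)), `⟪G u, v⟫ = ⟪u, G v⟫` («G is a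
  symmetric operator on L²(T_η)»), `‖G B‖ ≤ γ₀⁻¹‖B‖` and `‖∇_ν G B‖ ≤ γ₀⁻¹‖B‖`.

DICTIONARY / DIVERGENCES (this module): B5's `L²(T_η)` carries the weight `η^d` in the scalar
product; all statements here are for the unweighted `ℓ²` structure (`EuclideanSpace ℝ _`,
`dotProduct`), which changes neither symmetry nor the operator-norm bounds (both sides of (1.89)
scale by the same `η^{d/2}`), exactly as recorded for pass 27 (D-pv15g3.3). The constant `γ₀` is
ours (pass 27). Nothing printed is attributed beyond the quoted sentences; every `theorem` below
is kernel-checked from the typed definitions. value = kernel certificate, NOT summit progress.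
-/

namespace Literature.MathematicalPhysics.QuantumFieldTheory.Balaban1983to89.B5RealFields

open scoped BigOperators Matrix ComplexConjugate ComplexOrder Matrix.Norms.L2Operator
open Finset Complex Matrix
open Literature.MathematicalPhysics.QuantumFieldTheory.Balaban1983to89.B4Strip
open Literature.MathematicalPhysics.QuantumFieldTheory.Balaban1983to89.B5Prop11Plancherel
open Literature.MathematicalPhysics.QuantumFieldTheory.Balaban1983to89.B5Prop11Lower
open Literature.MathematicalPhysics.QuantumFieldTheory.Balaban1983to89.B5Action121
open Literature.MathematicalPhysics.QuantumFieldTheory.Balaban1983to89.B5Block118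
open Literature.MathematicalPhysics.QuantumFieldTheory.Balaban1983to89.B5LaplaceInverse
open Literature.MathematicalPhysics.QuantumFieldTheory.Balaban1983to89.B5Substitution125
open Literature.MathematicalPhysics.QuantumFieldTheory.Balaban1983to89.B5Projection127
open Literature.MathematicalPhysics.QuantumFieldTheory.Balaban1983to89.B5Value126
open Literature.MathematicalPhysics.QuantumFieldTheory.Balaban1983to89.B5DeltaA169
open Literature.MathematicalPhysics.QuantumFieldTheory.Balaban1983to89.B5Prop11Lattice

noncomputable section

/-! ## §1 Real matrices inside `Matrix _ _ ℂ` -/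

section IsReal

variable {m k l : Type*}

/-- «A : {b ⊂ T_ε} → ℝ», «a real valued function λ : T_ε → ℝ» (p. 18): all entries of the
complex matrix `A` are real. [cite: Balaban1984PropagatorsI, Sect. A p.18 (typed reading:
entrywise `conj a = a`)] -/
def IsReal (A : Matrix m k ℂ) : Prop := ∀ i j, conj (A i j) = A i j

/-- `A` is real iff `A^* = Aᵀ`. [folklore] -/
theorem isReal_iff_conjTranspose {A : Matrix m k ℂ} : IsReal A ↔ Aᴴ = Aᵀ := by
  constructor
  · intro h
    ext i j
    simp only [Matrix.conjTranspose_apply, Matrix.transpose_apply, Complex.star_def, h j i]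
  · intro h i j
    have hij := congrFun (congrFun h j) i
    simpa only [Matrix.conjTranspose_apply, Matrix.transpose_apply, Complex.star_def] using hij

/-- sums of real matrices are real. [folklore] -/
theorem IsReal.add {A B : Matrix m k ℂ} (hA : IsReal A) (hB : IsReal B) : IsReal (A + B) :=
  fun i j => by rw [Matrix.add_apply, map_add, hA, hB]

/-- differences of real matrices are real. [folklore] -/
theorem IsReal.sub {A B : Matrix m k ℂ} (hA : IsReal A) (hB : IsReal B) : IsReal (A - B) :=
  fun i j => by rw [Matrix.sub_apply, map_sub, hA, hB]

/-- negatives of real matrices are real. [folklore] -/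
theorem IsReal.neg {A : Matrix m k ℂ} (hA : IsReal A) : IsReal (-A) :=
  fun i j => by rw [Matrix.neg_apply, map_neg, hA]

/-- `0` is real. [folklore] -/
theorem IsReal.zero : IsReal (0 : Matrix m k ℂ) := fun i j => by simp

/-- `1` is real. [folklore] -/
theorem IsReal.one [DecidableEq m] : IsReal (1 : Matrix m m ℂ) := fun i j => by
  rw [Matrix.one_apply]
  split_ifs <;> simp

/-- real multiples (`conj c = c`) of real matrices are real. [folklore] -/
theorem IsReal.smul {A : Matrix m k ℂ} {c : ℂ} (hc : conj c = c) (hA : IsReal A) :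
    IsReal (c • A) :=
  fun i j => by rw [Matrix.smul_apply, smul_eq_mul, map_mul, hc, hA]

/-- products of real matrices are real. [folklore] -/
theorem IsReal.mul [Fintype k] {A : Matrix m k ℂ} {B : Matrix k l ℂ} (hA : IsReal A)
    (hB : IsReal B) : IsReal (A * B) := fun i j => by
  rw [Matrix.mul_apply, map_sum]
  exact Finset.sum_congr rfl fun x _ => by rw [map_mul, hA, hB]

/-- finite sums of real matrices are real. [folklore] -/
theorem IsReal.sum {ι : Type*} {s : Finset ι} {A : ι → Matrix m k ℂ}
    (hA : ∀ x ∈ s, IsReal (A x)) : IsReal (∑ x ∈ s, A x) := fun i j => by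
  rw [Matrix.sum_apply, map_sum]
  exact Finset.sum_congr rfl fun x hx => hA x hx i j

/-- the adjoint of a real matrix is real. [folklore] -/
theorem IsReal.conjTranspose {A : Matrix m k ℂ} (hA : IsReal A) : IsReal Aᴴ :=
  fun i j => by rw [Matrix.conjTranspose_apply, Complex.star_def, Complex.conj_conj, hA]

/-- `star A` of a real square matrix is real. [folklore] -/
theorem IsReal.star {A : Matrix m m ℂ} (hA : IsReal A) : IsReal (star A) := hA.conjTranspose

/-- the transpose of a real matrix is real. [folklore] -/
theorem IsReal.transpose {A : Matrix m k ℂ} (hA : IsReal A) : IsReal Aᵀ :=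
  fun i j => hA j i

/-- the inverse of a real matrix is real (`(A⁻¹)^* = (A^*)⁻¹ = (Aᵀ)⁻¹ = (A⁻¹)ᵀ`). [folklore] -/
theorem IsReal.inv [Fintype m] [DecidableEq m] {A : Matrix m m ℂ} (hA : IsReal A) :
    IsReal A⁻¹ := by
  rw [isReal_iff_conjTranspose] at hA ⊢
  rw [Matrix.conjTranspose_nonsing_inv, Matrix.transpose_nonsing_inv, hA]

/-- a real Hermitian matrix is symmetric. [folklore] -/
theorem IsReal.transpose_eq_of_isHermitian {A : Matrix m m ℂ} (hA : IsReal A)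
    (hH : A.IsHermitian) : Aᵀ = A := by
  rw [← isReal_iff_conjTranspose.mp hA]; exact hH

/-! ### the real part of a real matrix and the complexification of a real vector -/

/-- the entrywise real part `re ∘ A : Matrix m k ℝ`. [folklore] -/
def reM (A : Matrix m k ℂ) : Matrix m k ℝ := A.map Complex.re

/-- the complexification `(u_i) ↦ ((u_i : ℂ))` of a real vector. [folklore] -/
def cplx (u : m → ℝ) : m → ℂ := fun i => (u i : ℂ)

/-- entries of `re ∘ A`. [folklore] -/
@[simp] theorem reM_apply (A : Matrix m k ℂ) (i : m) (j : k) : reM A i j = (A i j).re := rfl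

/-- entries of the complexification. [folklore] -/
@[simp] theorem cplx_apply (u : m → ℝ) (i : m) : cplx u i = (u i : ℂ) := rfl

/-- for a real matrix, `((re A_{ij}) : ℂ) = A_{ij}`. [folklore] -/
theorem IsReal.coe_reM {A : Matrix m k ℂ} (hA : IsReal A) (i : m) (j : k) :
    ((reM A i j : ℝ) : ℂ) = A i j :=
  Complex.conj_eq_iff_re.mp (hA i j)

/-- a real matrix has vanishing imaginary parts. [folklore] -/
theorem IsReal.im_eq_zero {A : Matrix m k ℂ} (hA : IsReal A) (i : m) (j : k) : (A i j).im = 0 :=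
  Complex.conj_eq_iff_im.mp (hA i j)

/-- `(re A).map (↑) = A` for a real matrix. [folklore] -/
theorem IsReal.map_ofReal_reM {A : Matrix m k ℂ} (hA : IsReal A) :
    (reM A).map ((↑) : ℝ → ℂ) = A := by
  ext i j
  exact hA.coe_reM i j

/-- `re (A + B) = re A + re B`. [folklore] -/
theorem reM_add (A B : Matrix m k ℂ) : reM (A + B) = reM A + reM B := by
  ext i j; simp

/-- `re (A − B) = re A − re B`. [folklore] -/
theorem reM_sub (A B : Matrix m k ℂ) : reM (A - B) = reM A - reM B := by
  ext i j; simp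

/-- `re 1 = 1`. [folklore] -/
theorem reM_one [DecidableEq m] : reM (1 : Matrix m m ℂ) = 1 := by
  ext i j
  simp only [reM_apply, Matrix.one_apply]
  split_ifs <;> simp

/-- `re (r A) = r re A` for real `r`. [folklore] -/
theorem reM_smul_ofReal (r : ℝ) (A : Matrix m k ℂ) : reM ((r : ℂ) • A) = r • reM A := by
  ext i j; simp

/-- `re (A B) = (re A)(re B)` for real matrices. [folklore] -/
theorem IsReal.reM_mul [Fintype k] {A : Matrix m k ℂ} {B : Matrix k l ℂ} (hA : IsReal A)
    (hB : IsReal B) : reM (A * B) = reM A * reM B := by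
  ext i j
  simp only [reM_apply, Matrix.mul_apply, Complex.re_sum, Complex.mul_re, hA.im_eq_zero,
    hB.im_eq_zero, mul_zero, sub_zero]

/-- `re (A^*) = (re A)ᵀ`. [folklore] -/
theorem reM_conjTranspose (A : Matrix m k ℂ) : reM Aᴴ = (reM A)ᵀ := by
  ext i j
  simp [Matrix.conjTranspose_apply]

/-- `re (star A) = (re A)ᵀ`. [folklore] -/
theorem reM_star (A : Matrix m m ℂ) : reM (star A) = (reM A)ᵀ := reM_conjTranspose A

/-- a Hermitian matrix has symmetric real part. [folklore] -/
theorem reM_transpose_of_isHermitian {A : Matrix m m ℂ} (hH : A.IsHermitian) :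
    (reM A)ᵀ = reM A := by
  rw [← reM_conjTranspose, hH]

/-- the real part of the inverse of a real invertible matrix is the inverse of the real part.
[folklore] -/
theorem IsReal.reM_inv [Fintype m] [DecidableEq m] {A : Matrix m m ℂ} (hA : IsReal A)
    (h : A * A⁻¹ = 1) : (reM A)⁻¹ = reM A⁻¹ :=
  Matrix.inv_eq_right_inv (by rw [← hA.reM_mul hA.inv, h, reM_one])

/-- `(re A) u ↦ A (u : ℂ)`: the real action is the complex action on real vectors. [folklore] -/
theorem IsReal.cplx_mulVec [Fintype k] {A : Matrix m k ℂ} (hA : IsReal A) (u : k → ℝ) :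
    cplx (reM A *ᵥ u) = A *ᵥ cplx u := by
  funext i
  simp only [cplx_apply, Matrix.mulVec, dotProduct, Complex.ofReal_sum, Complex.ofReal_mul,
    hA.coe_reM]

/-- the complexification is additive. [folklore] -/
theorem cplx_add (u v : m → ℝ) : cplx (u + v) = cplx u + cplx v := by
  funext i; simp

/-- the complexification commutes with finite sums. [folklore] -/
theorem cplx_sum {ι : Type*} (s : Finset ι) (u : ι → m → ℝ) :
    cplx (∑ x ∈ s, u x) = ∑ x ∈ s, cplx (u x) := by
  funext i; simp [Finset.sum_apply]

/-- `(u : ℂ) = 0 ↔ u = 0`. [folklore] -/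
theorem cplx_eq_zero_iff (u : m → ℝ) : cplx u = 0 ↔ u = 0 := by
  simp [funext_iff, cplx]

/-- real vectors are self-conjugate. [folklore] -/
theorem star_cplx (u : m → ℝ) : star (cplx u) = cplx u := by
  funext i; simp [cplx]

/-- `⟨(u:ℂ), (v:ℂ)⟩ = (u · v : ℝ)`. [folklore] -/
theorem star_cplx_dotProduct [Fintype m] (u v : m → ℝ) :
    star (cplx u) ⬝ᵥ cplx v = ((u ⬝ᵥ v : ℝ) : ℂ) := by
  rw [star_cplx]
  simp [dotProduct, cplx, Complex.ofReal_sum, Complex.ofReal_mul]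

/-- `Σ_i |(u_i : ℂ)|² = Σ_i u_i²`. [folklore] -/
theorem nsq_cplx [Fintype m] (u : m → ℝ) : nsq (cplx u) = ∑ i, u i ^ 2 := by
  simp [nsq, cplx, Complex.norm_real, Real.norm_eq_abs, sq_abs]

end IsReal

/-! ## §2 Every typed operator of Sect. C is real -/

section Operators

variable {d : ℕ} (N : Fin d → ℕ) [∀ μ, NeZero (N μ)]

omit [∀ μ, NeZero (N μ)] in
/-- the translation `S_ν` (0/1 entries) is real. [folklore] -/
theorem isReal_shiftM (ν : Fin d) : IsReal (shiftM N ν) := fun i j => by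
  unfold shiftM
  split_ifs <;> simp

omit [∀ μ, NeZero (N μ)] in
/-- the scalar translation `S_ν` (0/1 entries) is real. [folklore] -/
theorem isReal_shiftS (ν : Fin d) : IsReal (shiftS N ν) := fun i j => by
  unfold shiftS
  split_ifs <;> simp

omit [∀ μ, NeZero (N μ)] in
/-- `∇_ν = c(S_ν − 1)` is real for a real lattice factor `c` ((1.31)).
[cite: Balaban1984PropagatorsI, (1.31) p.23 (typed reading)] -/
theorem isReal_fdiff {c : ℂ} (hc : conj c = c) (ν : Fin d) : IsReal (fdiff N c ν) :=
  IsReal.smul hc ((isReal_shiftM N ν).sub IsReal.one)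

omit [∀ μ, NeZero (N μ)] in
/-- `∂_ν = c(S_ν − 1)` is real for a real lattice factor ((1.4)).
[cite: Balaban1984PropagatorsI, (1.4) p.18 (typed reading)] -/
theorem isReal_sdiff {c : ℂ} (hc : conj c = c) (ν : Fin d) : IsReal (sdiff N c ν) :=
  IsReal.smul hc ((isReal_shiftS N ν).sub IsReal.one)

omit [∀ μ, NeZero (N μ)] in
/-- `∂` (vector of forward differences, (1.4)) is real for a real lattice factor.
[cite: Balaban1984PropagatorsI, (1.4) p.18 (typed reading)] -/
theorem isReal_GradOp {c : ℂ} (hc : conj c = c) : IsReal (GradOp N c) :=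
  fun i y => isReal_sdiff N hc i.2 i.1 y

/-- the scalar Laplacian `Δ = Σ_ν ∂_ν^*∂_ν` is real for a real lattice factor. [folklore] -/
theorem isReal_LapS {c : ℂ} (hc : conj c = c) : IsReal (LapS N c) :=
  IsReal.sum fun ν _ => (isReal_sdiff N hc ν).conjTranspose.mul (isReal_sdiff N hc ν)

/-- `conj U_{p,x} = U_{−p,x}` for the normalised DFT. [folklore] -/
theorem conj_dft_eq (p x : Tor N) : conj (dft N p x) = dft N (-p) x := by
  rw [conj_dft, dft_apply', conj_chi, neg_neg]

/-- a DFT sandwich `U* diag(m) U` with a real, even multiplier `m` is a real matrix. [folklore] -/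
theorem isReal_sandwich (mlt : Tor N → ℂ) (hre : ∀ p, conj (mlt p) = mlt p)
    (hev : ∀ p, mlt (-p) = mlt p) :
    IsReal ((dft N)ᴴ * Matrix.diagonal mlt * dft N) := by
  intro x y
  have hxy : ((dft N)ᴴ * Matrix.diagonal mlt * dft N) x y
      = ∑ p, star (dft N p x) * mlt p * dft N p y := by
    rw [Matrix.mul_apply]
    exact Finset.sum_congr rfl fun p _ => by
      rw [Matrix.mul_diagonal, Matrix.conjTranspose_apply]
  rw [hxy, map_sum]
  simp_rw [map_mul, Complex.star_def, Complex.conj_conj, hre]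
  refine Fintype.sum_equiv (Equiv.neg (Tor N)) _ _ fun p => ?_
  rw [Equiv.neg_apply, conj_dft_eq, conj_dft_eq, neg_neg, hev]

variable {N} in
/-- the symbol of `∂_ν` at a real lattice factor: `conj ∂_ν(p) = ∂_ν(−p)`. [folklore] -/
theorem conj_ssym {c : ℂ} (hc : conj c = c) (ν : Fin d) (p : Tor N) :
    conj (ssym N c ν p) = ssym N c ν (-p) := by
  simp only [ssym, map_mul, map_sub, map_one, hc, conj_stdAddChar, Pi.neg_apply]

variable {N} in
/-- `Δ(−p) = Δ(p)`. [folklore] -/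
theorem lsym_neg {c : ℂ} (hc : conj c = c) (p : Tor N) : lsym N c (-p) = lsym N c p := by
  simp only [lsym]
  exact Finset.sum_congr rfl fun ν _ => by
    rw [← conj_ssym hc, Complex.conj_conj, mul_comm]

/-- «Δ⁻¹ … putting its value on constant functions equal to 0» is a real operator.
[cite: Balaban1984PropagatorsI, Sect. C p.22 (typed reading)] -/
theorem isReal_LapSinv {c : ℂ} (hc : conj c = c) : IsReal (LapSinv N c) := by
  refine isReal_sandwich N (linv N c) (fun p => ?_) (fun p => ?_)
  · simp only [linv, apply_ite conj, map_zero, map_div₀, map_one, conj_lsym]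
  · simp only [linv, lsym_neg hc]

/-- the projection onto constants `Pker` is a real operator. [folklore] -/
theorem isReal_Pker {c : ℂ} (hc : conj c = c) : IsReal (Pker N c) := by
  refine isReal_sandwich N _ (fun p => ?_) (fun p => ?_)
  · simp only [apply_ite conj, map_zero, map_one]
  · simp only [lsym_neg hc]

variable (n : ℕ) [NeZero n] (M : Fin d → ℕ) [∀ μ, NeZero (M μ)]

omit [NeZero n] [∀ μ, NeZero (M μ)] in
/-- the block average `Q′_k` ((1.20)) is real. [cite: Balaban1984PropagatorsI, (1.20) p.20
(typed reading)] -/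
theorem isReal_QsOp : IsReal (QsOp n M) := fun y x => by
  simp only [QsOp, map_sum, apply_ite conj, map_div₀, map_one, map_pow, map_natCast, map_zero]

omit [NeZero n] [∀ μ, NeZero (M μ)] in
/-- the bond average `Q_k` ((1.18)) is real. [cite: Balaban1984PropagatorsI, (1.18) p.20
(typed reading)] -/
theorem isReal_QvOp : IsReal (QvOp n M) := fun b i => by
  simp only [QvOp, map_sum, apply_ite conj, map_div₀, map_one, map_pow, map_natCast, map_zero]

omit [NeZero n] [∀ μ, NeZero (M μ)] in
/-- `Q_k^* = η^{-d} Q_kᴴ` ((1.74) normalisation) is real. [cite: Balaban1984PropagatorsI,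
(1.74) p.30 (typed reading)] -/
theorem isReal_QvAdj : IsReal (QvAdj n M) :=
  IsReal.smul (by rw [map_pow, map_natCast]) (isReal_QvOp n M).conjTranspose

/-- the averaging matrix `C = |T|⁻¹ 𝟙` is real. [folklore] -/
theorem isReal_Cavg : IsReal (Cavg M) := fun _ _ => by
  simp only [Cavg, map_div₀, map_one, map_natCast]

/-- the vector Laplacian `Δ = Σ_ν ∇_ν^*∇_ν` ((1.90)) is real. [cite: Balaban1984PropagatorsI,
(1.90) p.33 (typed reading)] -/
theorem isReal_Lap : IsReal (Lap n M) :=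
  IsReal.sum fun ν _ =>
    (isReal_fdiff (fine n M) (map_natCast conj n) ν).conjTranspose.mul
      (isReal_fdiff (fine n M) (map_natCast conj n) ν)

/-- `Q′_kΔ⁻²Q′*_k` is real (real lattice factor). [cite: Balaban1984PropagatorsI, Sect. C p.22
(typed reading)] -/
theorem isReal_Mop {c : ℂ} (hc : conj c = c) : IsReal (Mop n M c) :=
  (((isReal_QsOp n M).mul ((isReal_LapSinv (fine n M) hc).mul
    (isReal_LapSinv (fine n M) hc))).mul (isReal_QsOp n M).conjTranspose)

/-- `K = Q′Δ⁻²Q′* + C` is real. [folklore] -/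
theorem isReal_Kmat {c : ℂ} (hc : conj c = c) : IsReal (Kmat n M c) :=
  (isReal_Mop n M hc).add (isReal_Cavg M)

/-- `(Q′_kΔ⁻²Q′*_k)⁻¹` is real. [cite: Balaban1984PropagatorsI, Sect. C p.22 (typed reading)] -/
theorem isReal_Minv {c : ℂ} (hc : conj c = c) : IsReal (Minv n M c) :=
  (isReal_Kmat n M hc).inv

/-- the projection `P = Δ⁻¹Q′*(Q′Δ⁻²Q′*)⁻¹Q′Δ⁻¹` is real. [cite: Balaban1984PropagatorsI,
Sect. C p.22 (typed reading)] -/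
theorem isReal_PcT {c : ℂ} (hc : conj c = c) : IsReal (PcT n M c) := by
  unfold PcT Pc
  exact ((((isReal_LapSinv (fine n M) hc).mul (isReal_QsOp n M).conjTranspose).mul
    (isReal_Minv n M hc)).mul (isReal_QsOp n M)).mul (isReal_LapSinv (fine n M) hc)

variable (a : ℝ)

/-- **`Δ_a` ((1.69)/(1.73)) is a real operator.** [cite: Balaban1984PropagatorsI, (1.73) p.30
(typed reading)] -/
theorem isReal_DeltaA : IsReal (DeltaA n M a) := by
  have hn : conj (n : ℂ) = n := map_natCast conj n
  unfold DeltaA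
  exact ((isReal_Lap n M).sub (((isReal_GradOp (fine n M) hn).mul (isReal_PcT n M hn)).mul
    (isReal_GradOp (fine n M) hn).conjTranspose)).add
    (IsReal.smul (Complex.conj_ofReal a) ((isReal_QvAdj n M).mul (isReal_QvOp n M)))

/-- **`G = Δ_a⁻¹` ((1.71)) is a real operator.** [cite: Balaban1984PropagatorsI, (1.71) p.30
(typed reading)] -/
theorem isReal_DeltaA_inv : IsReal (DeltaA n M a)⁻¹ := (isReal_DeltaA n M a).inv

end Operators

/-! ## §3 The real matrices `Δ_a`, `G` and Prop. 1.1 for real vector fields -/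

section RealModel

variable {d : ℕ} (n : ℕ) [NeZero n] (hn : 1 ≤ n) (M : Fin d → ℕ) [hM : ∀ μ, NeZero (M μ)]
  (a : ℝ) (ha : 0 < a)

/-- the real matrix of `Δ_a` on real vector fields `T_η × {1..d} → ℝ`.
[cite: Balaban1984PropagatorsI, (1.73) p.30 (typed reading)] -/
def DeltaAR : Matrix (Tor (fine n M) × Fin d) (Tor (fine n M) × Fin d) ℝ := reM (DeltaA n M a)

/-- the real matrix of «Δ_a⁻¹ = G_k, or simply G» ((1.71)) on real vector fields.
[cite: Balaban1984PropagatorsI, (1.71) p.30 (typed reading)] -/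
def GR : Matrix (Tor (fine n M) × Fin d) (Tor (fine n M) × Fin d) ℝ := reM (DeltaA n M a)⁻¹

/-- the real matrix of `Δ = Σ_ν ∇_ν^*∇_ν` on real vector fields ((1.90)).
[cite: Balaban1984PropagatorsI, (1.90) p.33 (typed reading)] -/
def LapR : Matrix (Tor (fine n M) × Fin d) (Tor (fine n M) × Fin d) ℝ := reM (Lap n M)

/-- the real matrix of `∇_ν` ((1.31), lattice factor `η⁻¹ = n`).
[cite: Balaban1984PropagatorsI, (1.31) p.23 (typed reading)] -/
def fdiffR (ν : Fin d) : Matrix (Tor (fine n M) × Fin d) (Tor (fine n M) × Fin d) ℝ :=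
  reM (fdiff (fine n M) (n : ℂ) ν)

/-- `(re Δ_a : ℂ) = Δ_a`: the real matrix complexifies back to the typed `Δ_a`. [folklore] -/
theorem DeltaAR_map_ofReal : (DeltaAR n M a).map ((↑) : ℝ → ℂ) = DeltaA n M a :=
  (isReal_DeltaA n M a).map_ofReal_reM

/-- `(re G : ℂ) = G = Δ_a⁻¹`. [folklore] -/
theorem GR_map_ofReal : (GR n M a).map ((↑) : ℝ → ℂ) = (DeltaA n M a)⁻¹ :=
  (isReal_DeltaA_inv n M a).map_ofReal_reM

/-- `(re Δ : ℂ) = Δ`. [folklore] -/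
theorem LapR_map_ofReal : (LapR n M).map ((↑) : ℝ → ℂ) = Lap n M :=
  (isReal_Lap n M).map_ofReal_reM

omit [NeZero n] hM in
/-- `(re ∇_ν : ℂ) = ∇_ν`. [folklore] -/
theorem fdiffR_map_ofReal (ν : Fin d) :
    (fdiffR n M ν).map ((↑) : ℝ → ℂ) = fdiff (fine n M) (n : ℂ) ν :=
  (isReal_fdiff (fine n M) (map_natCast conj n) ν).map_ofReal_reM

omit [NeZero n] hM in
/-- `(re ∇_ν)ᵀ = re (∇_ν^*)`. [folklore] -/
theorem fdiffR_transpose (ν : Fin d) :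
    (fdiffR n M ν)ᵀ = reM (star (fdiff (fine n M) (n : ℂ) ν)) :=
  (reM_star _).symm

/-- `Δ = Σ_ν ∇_ν^*∇_ν` is Hermitian. [folklore] -/
theorem Lap_isHermitian : (Lap n M).IsHermitian := by
  unfold Lap Matrix.IsHermitian
  rw [Matrix.conjTranspose_sum]
  exact Finset.sum_congr rfl fun ν _ => by
    rw [Matrix.conjTranspose_mul, Matrix.conjTranspose_conjTranspose]

/-- the real vector Laplacian is symmetric. [folklore] -/
theorem LapR_transpose : (LapR n M)ᵀ = LapR n M :=
  reM_transpose_of_isHermitian (Lap_isHermitian n M)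

include hn ha

/-- `Δ_a` is symmetric on real vector fields. [cite: Balaban1984PropagatorsI, Prop. 1.1 p.33
(«G is a symmetric operator»; typed reading)] -/
theorem DeltaAR_transpose : (DeltaAR n M a)ᵀ = DeltaAR n M a :=
  reM_transpose_of_isHermitian (DeltaA_isHermitian n hn M a ha)

/-- (1.71) over `ℝ`: `Δ_a G = 1`. [cite: Balaban1984PropagatorsI, (1.71) p.30 (proof ours)] -/
theorem DeltaAR_mul_GR : DeltaAR n M a * GR n M a = 1 := by
  rw [DeltaAR, GR, ← (isReal_DeltaA n M a).reM_mul (isReal_DeltaA_inv n M a),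
    ← calG_eq_DeltaA_inv n hn M a ha, DeltaA_mul_calG n hn M a ha, reM_one]

/-- (1.71) over `ℝ`: `G Δ_a = 1`. [cite: Balaban1984PropagatorsI, (1.71) p.30 (proof ours)] -/
theorem GR_mul_DeltaAR : GR n M a * DeltaAR n M a = 1 := by
  rw [DeltaAR, GR, ← (isReal_DeltaA_inv n M a).reM_mul (isReal_DeltaA n M a),
    ← calG_eq_DeltaA_inv n hn M a ha, calG_mul_DeltaA n hn M a ha, reM_one]

/-- «Δ_a⁻¹ = G_k, or simply G» ((1.71)) over `ℝ`. [cite: Balaban1984PropagatorsI, (1.71) p.30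
(proof ours)] -/
theorem GR_eq_inv : GR n M a = (DeltaAR n M a)⁻¹ :=
  (Matrix.inv_eq_right_inv (DeltaAR_mul_GR n hn M a ha)).symm

/-- **«The operator G is a symmetric operator on L²(T_η)»**, real form: `Gᵀ = G`.
[cite: Balaban1984PropagatorsI, Prop. 1.1 p.33 (proof ours)] -/
theorem GR_transpose : (GR n M a)ᵀ = GR n M a :=
  reM_transpose_of_isHermitian (DeltaA_inv_isHermitian n hn M a ha)

/-- `⟨Gu, v⟩ = ⟨u, Gv⟩` for real vector fields. [cite: Balaban1984PropagatorsI, Prop. 1.1 p.33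
(proof ours)] -/
theorem GR_mulVec_dotProduct (u v : Tor (fine n M) × Fin d → ℝ) :
    (GR n M a *ᵥ u) ⬝ᵥ v = u ⬝ᵥ (GR n M a *ᵥ v) := by
  rw [Matrix.dotProduct_mulVec, ← Matrix.mulVec_transpose, GR_transpose n hn M a ha]

omit hn ha in
/-- the real quadratic form of a real operator is the complex one on real vectors. [folklore] -/
theorem form_cplx {A : Matrix (Tor (fine n M) × Fin d) (Tor (fine n M) × Fin d) ℂ}
    (hA : IsReal A) (x : Tor (fine n M) × Fin d → ℝ) :
    star (cplx x) ⬝ᵥ (A *ᵥ cplx x) = ((x ⬝ᵥ (reM A *ᵥ x) : ℝ) : ℂ) := by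
  rw [← hA.cplx_mulVec, star_cplx_dotProduct]

/-- **`Δ_a` is positive definite on real vector fields.** [cite: Balaban1984PropagatorsI, (1.73)
p.30 (proof ours)] -/
theorem DeltaAR_posDef : (DeltaAR n M a).PosDef := by
  refine Matrix.PosDef.of_dotProduct_mulVec_pos ?_ fun x hx => ?_
  · rw [Matrix.IsHermitian, Matrix.conjTranspose_eq_transpose_of_trivial,
      DeltaAR_transpose n hn M a ha]
  · have hx' : cplx x ≠ 0 := fun h => hx ((cplx_eq_zero_iff x).mp h)
    have h := (DeltaA_posDef n hn M a ha).dotProduct_mulVec_pos hx'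
    rw [form_cplx n M (isReal_DeltaA n M a), Complex.zero_lt_real] at h
    rw [star_trivial]
    exact h

/-- **`G` is positive definite on real vector fields.** [cite: Balaban1984PropagatorsI, Prop. 1.1
p.33 (proof ours)] -/
theorem GR_posDef : (GR n M a).PosDef := by
  refine Matrix.PosDef.of_dotProduct_mulVec_pos ?_ fun x hx => ?_
  · rw [Matrix.IsHermitian, Matrix.conjTranspose_eq_transpose_of_trivial, GR_transpose n hn M a ha]
  · have hx' : cplx x ≠ 0 := fun h => hx ((cplx_eq_zero_iff x).mp h)
    have h := (DeltaA_inv_posDef n hn M a ha).dotProduct_mulVec_pos hx'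
    rw [form_cplx n M (isReal_DeltaA_inv n M a), Complex.zero_lt_real] at h
    rw [star_trivial]
    exact h

omit hn ha in
/-- `Δ_a A = J` over `ℝ` iff over `ℂ` (for real `A`, `J`). [folklore] -/
theorem DeltaAR_mulVec_eq_iff (A J : Tor (fine n M) × Fin d → ℝ) :
    DeltaAR n M a *ᵥ A = J ↔ DeltaA n M a *ᵥ cplx A = cplx J := by
  rw [← (isReal_DeltaA n M a).cplx_mulVec]
  constructor
  · intro h; rw [← DeltaAR, h]
  · intro h; funext i
    have hi := congrFun h i
    simpa only [cplx_apply, Complex.ofReal_inj, DeltaAR] using hi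

/-- **(1.73) for real data**: for every real `J` there is exactly one REAL vector field `A` with
`Δ_a A = J` (namely `A = GJ`). [cite: Balaban1984PropagatorsI, (1.73) p.30 (proof ours)] -/
theorem existsUnique_real_solution (J : Tor (fine n M) × Fin d → ℝ) :
    ∃! A : Tor (fine n M) × Fin d → ℝ, DeltaAR n M a *ᵥ A = J := by
  refine ⟨GR n M a *ᵥ J, ?_, fun A hA => ?_⟩
  · show DeltaAR n M a *ᵥ (GR n M a *ᵥ J) = J
    rw [Matrix.mulVec_mulVec, DeltaAR_mul_GR n hn M a ha, Matrix.one_mulVec]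
  · rw [← hA, Matrix.mulVec_mulVec, GR_mul_DeltaAR n hn M a ha, Matrix.one_mulVec]

/-! ### real `ℓ²` norms and the transfer of (1.89) -/

omit hn ha

/-- `‖u‖ = (Σ_i u_i²)^{1/2}` for a real field. [folklore] -/
def l2R {m : Type*} [Fintype m] (u : m → ℝ) : ℝ := Real.sqrt (∑ i, u i ^ 2)

/-- `‖F‖ = (Σ_s Σ_i F_{s,i}²)^{1/2}` for a real tensor field. [folklore] -/
def l2TR {m S : Type*} [Fintype m] [Fintype S] (F : S → m → ℝ) : ℝ :=
  Real.sqrt (∑ s, ∑ i, F s i ^ 2)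

omit [NeZero n] hM in
/-- `‖u‖_ℝ = ‖(u : ℂ)‖`. [folklore] -/
theorem l2R_eq {m : Type*} [Fintype m] [DecidableEq m] (u : m → ℝ) : l2R u = l2 (cplx u) := by
  rw [l2R, l2, nsq_cplx]

omit [NeZero n] hM in
/-- `‖F‖_ℝ = ‖(F : ℂ)‖` for tensor fields. [folklore] -/
theorem l2TR_eq {m S : Type*} [Fintype m] [DecidableEq m] [Fintype S] (F : S → m → ℝ) :
    l2TR F = l2T (fun s => cplx (F s)) := by
  simp only [l2TR, l2T, nsq_cplx]

omit [NeZero n] hM in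
/-- `l2R` is the Euclidean norm. [folklore] -/
theorem l2R_eq_norm {m : Type*} [Fintype m] (u : m → ℝ) :
    l2R u = ‖(WithLp.toLp 2 u : EuclideanSpace ℝ m)‖ := by
  rw [l2R, EuclideanSpace.norm_eq]
  congr 1
  exact Finset.sum_congr rfl fun i _ => by simp [Real.norm_eq_abs, sq_abs]

omit [NeZero n] hM in
/-- `0 ≤ ‖u‖`. [folklore] -/
theorem l2R_nonneg {m : Type*} [Fintype m] (u : m → ℝ) : 0 ≤ l2R u := Real.sqrt_nonneg _

omit [NeZero n] hM in
/-- one component of a tensor field is bounded by the whole field. [folklore] -/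
theorem l2R_le_l2TR {m S : Type*} [Fintype m] [Fintype S] (F : S → m → ℝ) (s : S) :
    l2R (F s) ≤ l2TR F :=
  Real.sqrt_le_sqrt (Finset.single_le_sum (f := fun s => ∑ i, F s i ^ 2)
    (fun _ _ => Finset.sum_nonneg fun _ _ => sq_nonneg _) (Finset.mem_univ s))

/-- the real gradient `(∇B)_ν = ∇_ν B`. [cite: Balaban1984PropagatorsI, (1.89) p.33] -/
def gradR (B : Tor (fine n M) × Fin d → ℝ) : Fin d → (Tor (fine n M) × Fin d → ℝ) :=
  fun ν => fdiffR n M ν *ᵥ B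

/-- the real second gradient `(∇∇B)_{νν′} = ∇_ν∇_{ν′}B`. [cite: Balaban1984PropagatorsI, (1.89) p.33] -/
def grad2R (B : Tor (fine n M) × Fin d → ℝ) : Fin d × Fin d → (Tor (fine n M) × Fin d → ℝ) :=
  fun p => fdiffR n M p.1 *ᵥ (fdiffR n M p.2 *ᵥ B)

/-- the real divergence `∇*J = Σ_ν ∇_νᵀ J_ν`. [cite: Balaban1984PropagatorsI, (1.89) p.33] -/
def divTR (J : Fin d → (Tor (fine n M) × Fin d → ℝ)) : Tor (fine n M) × Fin d → ℝ :=
  ∑ ν, (fdiffR n M ν)ᵀ *ᵥ J ν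

/-- the real double divergence `∇*∇*J = Σ_{νν′} ∇_νᵀ∇_{ν′}ᵀ J_{νν′}`.
[cite: Balaban1984PropagatorsI, (1.89) p.33] -/
def divT2R (J : Fin d × Fin d → (Tor (fine n M) × Fin d → ℝ)) : Tor (fine n M) × Fin d → ℝ :=
  ∑ p, (fdiffR n M p.1)ᵀ *ᵥ ((fdiffR n M p.2)ᵀ *ᵥ J p)

/-- `(G J : ℂ) = G (J : ℂ)` for real `J`. [folklore] -/
theorem cplx_GR_mulVec (J : Tor (fine n M) × Fin d → ℝ) :
    cplx (GR n M a *ᵥ J) = (DeltaA n M a)⁻¹ *ᵥ cplx J :=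
  (isReal_DeltaA_inv n M a).cplx_mulVec J

/-- `(∇_ν B : ℂ) = ∇_ν (B : ℂ)` for real `B`. [folklore] -/
theorem cplx_fdiffR_mulVec (ν : Fin d) (B : Tor (fine n M) × Fin d → ℝ) :
    cplx (fdiffR n M ν *ᵥ B) = fdiff (fine n M) (n : ℂ) ν *ᵥ cplx B :=
  (isReal_fdiff (fine n M) (map_natCast conj n) ν).cplx_mulVec B

/-- `(∇_νᵀ B : ℂ) = ∇_ν^* (B : ℂ)` for real `B`. [folklore] -/
theorem cplx_fdiffR_transpose_mulVec (ν : Fin d) (B : Tor (fine n M) × Fin d → ℝ) :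
    cplx ((fdiffR n M ν)ᵀ *ᵥ B) = star (fdiff (fine n M) (n : ℂ) ν) *ᵥ cplx B := by
  rw [fdiffR_transpose]
  exact (isReal_fdiff (fine n M) (map_natCast conj n) ν).star.cplx_mulVec B

/-- the real gradient complexifies to the typed gradient. [folklore] -/
theorem cplx_gradR (B : Tor (fine n M) × Fin d → ℝ) (ν : Fin d) :
    cplx (gradR n M B ν) = grad n M (cplx B) ν :=
  cplx_fdiffR_mulVec n M ν B

/-- the real second gradient complexifies to the typed one. [folklore] -/
theorem cplx_grad2R (B : Tor (fine n M) × Fin d → ℝ) (p : Fin d × Fin d) :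
    cplx (grad2R n M B p) = grad2 n M (cplx B) p := by
  simp only [grad2R, grad2, cplx_fdiffR_mulVec]

/-- the real divergence complexifies to the typed one. [folklore] -/
theorem cplx_divTR (J : Fin d → (Tor (fine n M) × Fin d → ℝ)) :
    cplx (divTR n M J) = divT n M (fun ν => cplx (J ν)) := by
  simp only [divTR, divT, cplx_sum, cplx_fdiffR_transpose_mulVec]

/-- the real double divergence complexifies to the typed one. [folklore] -/
theorem cplx_divT2R (J : Fin d × Fin d → (Tor (fine n M) × Fin d → ℝ)) :
    cplx (divT2R n M J) = divT2 n M (fun p => cplx (J p)) := by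
  simp only [divT2R, divT2, cplx_sum, cplx_fdiffR_transpose_mulVec]

include hn ha

/-- **(1.89), real fields: `‖GJ‖ ≤ γ₀⁻¹‖J‖`.** [cite: Balaban1984PropagatorsI, Prop. 1.1 (1.89)
p.33 (kernel version; constant and proof ours)] -/
theorem ineq189R_G (J : Tor (fine n M) × Fin d → ℝ) :
    l2R (GR n M a *ᵥ J) ≤ (gammaZero d a)⁻¹ * l2R J := by
  rw [l2R_eq, l2R_eq, cplx_GR_mulVec]
  exact ineq189_G n hn M a ha (cplx J)

/-- **(1.89), real fields: `‖∇GJ‖ ≤ γ₀⁻¹‖J‖`.** [cite: Balaban1984PropagatorsI, Prop. 1.1 (1.89)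
p.33 (kernel version; constant and proof ours)] -/
theorem ineq189R_gradG (J : Tor (fine n M) × Fin d → ℝ) :
    l2TR (gradR n M (GR n M a *ᵥ J)) ≤ (gammaZero d a)⁻¹ * l2R J := by
  rw [l2TR_eq, l2R_eq]
  simp only [cplx_gradR, cplx_GR_mulVec]
  exact ineq189_gradG n hn M a ha (cplx J)

/-- (1.89), real fields, one direction: `‖∇_ν GJ‖ ≤ γ₀⁻¹‖J‖`. [cite: Balaban1984PropagatorsI,
Prop. 1.1 (1.89) p.33 (kernel version; constant and proof ours)] -/
theorem ineq189R_gradG_dir (ν : Fin d) (J : Tor (fine n M) × Fin d → ℝ) :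
    l2R (fdiffR n M ν *ᵥ (GR n M a *ᵥ J)) ≤ (gammaZero d a)⁻¹ * l2R J :=
  (l2R_le_l2TR (gradR n M (GR n M a *ᵥ J)) ν).trans (ineq189R_gradG n hn M a ha J)

/-- **(1.89), real fields: `‖G∇*J‖ ≤ γ₀⁻¹‖J‖`.** [cite: Balaban1984PropagatorsI, Prop. 1.1
(1.89) p.33 (kernel version; constant and proof ours)] -/
theorem ineq189R_GdivT (J : Fin d → (Tor (fine n M) × Fin d → ℝ)) :
    l2R (GR n M a *ᵥ divTR n M J) ≤ (gammaZero d a)⁻¹ * l2TR J := by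
  rw [l2R_eq, l2TR_eq, cplx_GR_mulVec, cplx_divTR]
  exact ineq189_GdivT n hn M a ha _

/-- **(1.89), real fields: `‖∇G∇*J‖ ≤ γ₀⁻¹‖J‖`.** [cite: Balaban1984PropagatorsI, Prop. 1.1
(1.89) p.33 (kernel version; constant and proof ours)] -/
theorem ineq189R_gradGdivT (J : Fin d → (Tor (fine n M) × Fin d → ℝ)) :
    l2TR (gradR n M (GR n M a *ᵥ divTR n M J)) ≤ (gammaZero d a)⁻¹ * l2TR J := by
  rw [l2TR_eq, l2TR_eq]
  simp only [cplx_gradR, cplx_GR_mulVec, cplx_divTR]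
  exact ineq189_gradGdivT n hn M a ha _

/-- **(1.89), real fields: `‖∇∇GJ‖ ≤ γ₀⁻¹‖J‖`.** [cite: Balaban1984PropagatorsI, Prop. 1.1
(1.89) p.33 (kernel version; constant and proof ours)] -/
theorem ineq189R_grad2G (J : Tor (fine n M) × Fin d → ℝ) :
    l2TR (grad2R n M (GR n M a *ᵥ J)) ≤ (gammaZero d a)⁻¹ * l2R J := by
  rw [l2TR_eq, l2R_eq]
  simp only [cplx_grad2R, cplx_GR_mulVec]
  exact ineq189_grad2G n hn M a ha (cplx J)

/-- **(1.89), real fields: `‖G∇*∇*J‖ ≤ γ₀⁻¹‖J‖`.** [cite: Balaban1984PropagatorsI, Prop. 1.1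
(1.89) p.33 (kernel version; constant and proof ours)] -/
theorem ineq189R_GdivT2 (J : Fin d × Fin d → (Tor (fine n M) × Fin d → ℝ)) :
    l2R (GR n M a *ᵥ divT2R n M J) ≤ (gammaZero d a)⁻¹ * l2TR J := by
  rw [l2R_eq, l2TR_eq, cplx_GR_mulVec, cplx_divT2R]
  exact ineq189_GdivT2 n hn M a ha _

/-- **(1.90), real fields, as quadratic forms: `γ₀⟨A, (Δ + I)A⟩ ≤ ⟨A, Δ_a A⟩`.**
[cite: Balaban1984PropagatorsI, Prop. 1.1 (1.90) p.33 (kernel version; constant and proof ours)] -/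
theorem ineq190R_form (A : Tor (fine n M) × Fin d → ℝ) :
    gammaZero d a * (A ⬝ᵥ ((LapR n M + 1) *ᵥ A)) ≤ A ⬝ᵥ (DeltaAR n M a *ᵥ A) := by
  have h := ineq190_form n hn M a ha (cplx A)
  have hL : IsReal (Lap n M + 1) := (isReal_Lap n M).add IsReal.one
  rw [form_cplx n M hL, form_cplx n M (isReal_DeltaA n M a), Complex.ofReal_re,
    Complex.ofReal_re, reM_add, reM_one] at h
  exact h

open scoped MatrixOrder in
/-- **(1.90), real fields, in the Löwner order of real symmetric matrices: `γ₀(Δ + I) ≤ Δ_a`.**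
[cite: Balaban1984PropagatorsI, Prop. 1.1 (1.90) p.33 (kernel version; constant and proof ours)] -/
theorem ineq190R : gammaZero d a • (LapR n M + 1) ≤ DeltaAR n M a := by
  rw [Matrix.le_iff]
  refine Matrix.PosSemidef.of_dotProduct_mulVec_nonneg ?_ fun x => ?_
  · rw [Matrix.IsHermitian, Matrix.conjTranspose_eq_transpose_of_trivial, Matrix.transpose_sub,
      Matrix.transpose_smul, Matrix.transpose_add, Matrix.transpose_one,
      DeltaAR_transpose n hn M a ha, LapR_transpose]
  · have h := ineq190R_form n hn M a ha x
    rw [star_trivial, Matrix.sub_mulVec, dotProduct_sub, Matrix.smul_mulVec, dotProduct_smul,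
      smul_eq_mul]
    linarith

end RealModel

section

open scoped MatrixOrder in
/-- **Proposition 1.1 for REAL vector fields, in the printed quantifier order** («with a
positive constant γ₀ independent of k, T_η, and depending on d only (if we put a = 1)»): one
`γ₀ = γ₀(d, a) > 0` such that for every `k` (`n = L^k ≥ 1`) and every torus (`M`), `G = Δ_a⁻¹`
is symmetric, inverts `Δ_a`, and satisfies the six bounds of (1.89) and (1.90) (as a quadratic
form inequality and in the Löwner order) on real fields. [cite: Balaban1984PropagatorsI, Prop. 1.1
(1.89)–(1.90) p.33 (kernel version; constant and proof ours)] -/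
theorem prop11_real {d : ℕ} (a : ℝ) (ha : 0 < a) :
    ∃ γ₀ : ℝ, 0 < γ₀ ∧ ∀ (n : ℕ) [NeZero n], 1 ≤ n → ∀ (M : Fin d → ℕ) [∀ μ, NeZero (M μ)],
      (GR n M a)ᵀ = GR n M a ∧ DeltaAR n M a * GR n M a = 1 ∧ GR n M a * DeltaAR n M a = 1 ∧
      (∀ J, l2R (GR n M a *ᵥ J) ≤ γ₀⁻¹ * l2R J) ∧
      (∀ J, l2TR (gradR n M (GR n M a *ᵥ J)) ≤ γ₀⁻¹ * l2R J) ∧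
      (∀ J, l2R (GR n M a *ᵥ divTR n M J) ≤ γ₀⁻¹ * l2TR J) ∧
      (∀ J, l2TR (gradR n M (GR n M a *ᵥ divTR n M J)) ≤ γ₀⁻¹ * l2TR J) ∧
      (∀ J, l2TR (grad2R n M (GR n M a *ᵥ J)) ≤ γ₀⁻¹ * l2R J) ∧
      (∀ J, l2R (GR n M a *ᵥ divT2R n M J) ≤ γ₀⁻¹ * l2TR J) ∧
      (∀ A, γ₀ * (A ⬝ᵥ ((LapR n M + 1) *ᵥ A)) ≤ A ⬝ᵥ (DeltaAR n M a *ᵥ A)) ∧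
      γ₀ • (LapR n M + 1) ≤ DeltaAR n M a :=
  ⟨gammaZero d a, gammaZero_pos d a, fun n _ hn M _ =>
    ⟨GR_transpose n hn M a ha, DeltaAR_mul_GR n hn M a ha, GR_mul_DeltaAR n hn M a ha,
      ineq189R_G n hn M a ha, ineq189R_gradG n hn M a ha, ineq189R_GdivT n hn M a ha,
      ineq189R_gradGdivT n hn M a ha, ineq189R_grad2G n hn M a ha, ineq189R_GdivT2 n hn M a ha,
      ineq190R_form n hn M a ha, ineq190R n hn M a ha⟩⟩

end


/-! ## §4 `G`, `Δ_a`, `∇_ν` as endomorphisms of the real Euclidean space of vector fields -/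

section Euclidean

variable {d : ℕ} (n : ℕ) [NeZero n] (hn : 1 ≤ n) (M : Fin d → ℕ) [hM : ∀ μ, NeZero (M μ)]
  (a : ℝ) (ha : 0 < a)

/-- the real Hilbert space of vector fields on `T_η` (unweighted `ℓ²`; B5's `L²(T_η)` carries the
constant weight `η^d`). [cite: Balaban1984PropagatorsI, Prop. 1.1 p.33 (typed reading)] -/
abbrev VecField : Type := EuclideanSpace ℝ (Tor (fine n M) × Fin d)

/-- `G = Δ_a⁻¹` as an endomorphism of `L²(T_η)` (real). [cite: Balaban1984PropagatorsI, (1.71)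
p.30, Prop. 1.1 p.33 (typed reading)] -/
def GEnd : Module.End ℝ (VecField n M) := Matrix.toEuclideanLin (GR n M a)

/-- `Δ_a` as an endomorphism of `L²(T_η)` (real). [cite: Balaban1984PropagatorsI, (1.73) p.30
(typed reading)] -/
def DeltaAEnd : Module.End ℝ (VecField n M) := Matrix.toEuclideanLin (DeltaAR n M a)

/-- `∇_ν` as an endomorphism of `L²(T_η)` (real). [cite: Balaban1984PropagatorsI, (1.31) p.23
(typed reading)] -/
def fdiffEnd (ν : Fin d) : Module.End ℝ (VecField n M) := Matrix.toEuclideanLin (fdiffR n M ν)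

/-- `G v = (G_matrix · v)` on `L²(T_η)`. [folklore] -/
theorem GEnd_apply (v : VecField n M) :
    GEnd n M a v = WithLp.toLp 2 (GR n M a *ᵥ WithLp.ofLp v) := rfl

/-- `Δ_a v = (Δ_a-matrix · v)` on `L²(T_η)`. [folklore] -/
theorem DeltaAEnd_apply (v : VecField n M) :
    DeltaAEnd n M a v = WithLp.toLp 2 (DeltaAR n M a *ᵥ WithLp.ofLp v) := rfl

/-- `∇_ν v = (∇_ν-matrix · v)` on `L²(T_η)`. [folklore] -/
theorem fdiffEnd_apply (ν : Fin d) (v : VecField n M) :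
    fdiffEnd n M ν v = WithLp.toLp 2 (fdiffR n M ν *ᵥ WithLp.ofLp v) := rfl

include hn ha

/-- **(1.71) `Δ_a G = 1`** in `End(L²(T_η))`. [cite: Balaban1984PropagatorsI, (1.71) p.30
(proof ours)] -/
theorem DeltaAEnd_mul_GEnd : DeltaAEnd n M a * GEnd n M a = 1 := by
  rw [DeltaAEnd, GEnd, Module.End.mul_eq_comp, Module.End.one_eq_id, Matrix.toEuclideanLin,
    ← Matrix.toLpLin_mul_same, DeltaAR_mul_GR n hn M a ha, Matrix.toLpLin_one]

/-- **(1.71) `G Δ_a = 1`** in `End(L²(T_η))`. [cite: Balaban1984PropagatorsI, (1.71) p.30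
(proof ours)] -/
theorem GEnd_mul_DeltaAEnd : GEnd n M a * DeltaAEnd n M a = 1 := by
  rw [DeltaAEnd, GEnd, Module.End.mul_eq_comp, Module.End.one_eq_id, Matrix.toEuclideanLin,
    ← Matrix.toLpLin_mul_same, GR_mul_DeltaAR n hn M a ha, Matrix.toLpLin_one]

/-- **«The operator G is a symmetric operator on L²(T_η)»**: `⟪Gu, v⟫ = ⟪u, Gv⟫`.
[cite: Balaban1984PropagatorsI, Prop. 1.1 p.33 (proof ours)] -/
theorem GEnd_symm (u v : VecField n M) :
    inner ℝ (GEnd n M a u) v = inner ℝ u (GEnd n M a v) := by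
  simp only [GEnd_apply, EuclideanSpace.inner_eq_star_dotProduct, star_trivial]
  rw [Matrix.dotProduct_mulVec, ← Matrix.mulVec_transpose, GR_transpose n hn M a ha]

/-- `Δ_a` is symmetric on `L²(T_η)`. [cite: Balaban1984PropagatorsI, Prop. 1.1 p.33 (proof ours)] -/
theorem DeltaAEnd_symm (u v : VecField n M) :
    inner ℝ (DeltaAEnd n M a u) v = inner ℝ u (DeltaAEnd n M a v) := by
  simp only [DeltaAEnd_apply, EuclideanSpace.inner_eq_star_dotProduct, star_trivial]
  rw [Matrix.dotProduct_mulVec, ← Matrix.mulVec_transpose, DeltaAR_transpose n hn M a ha]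

/-- `G` is positive: `0 < ⟪GB, B⟫` for `B ≠ 0`. [cite: Balaban1984PropagatorsI, Prop. 1.1 p.33
(proof ours)] -/
theorem GEnd_inner_pos (B : VecField n M) (hB : B ≠ 0) : 0 < inner ℝ (GEnd n M a B) B := by
  simp only [GEnd_apply, EuclideanSpace.inner_eq_star_dotProduct, star_trivial]
  have hB' : WithLp.ofLp B ≠ 0 := fun h => hB (by
    have := congrArg (WithLp.toLp 2) h
    simpa using this)
  have h := (GR_posDef n hn M a ha).dotProduct_mulVec_pos hB'
  rw [star_trivial] at h
  exact h

omit hn ha in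
/-- the norm of `L²(T_η)` is the real `ℓ²` norm. [folklore] -/
theorem norm_eq_l2R (v : VecField n M) : ‖v‖ = l2R (WithLp.ofLp v) := by
  rw [l2R_eq_norm, WithLp.toLp_ofLp]

/-- **(1.89) `‖GB‖ ≤ γ₀⁻¹‖B‖`** on `L²(T_η)` (real). [cite: Balaban1984PropagatorsI, Prop. 1.1
(1.89) p.33 (kernel version; constant and proof ours)] -/
theorem norm_GEnd_le (B : VecField n M) : ‖GEnd n M a B‖ ≤ (gammaZero d a)⁻¹ * ‖B‖ := by
  rw [GEnd_apply, ← l2R_eq_norm, norm_eq_l2R]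
  exact ineq189R_G n hn M a ha _

/-- **(1.89) `‖∇_ν GB‖ ≤ γ₀⁻¹‖B‖`** on `L²(T_η)` (real), each direction `ν`.
[cite: Balaban1984PropagatorsI, Prop. 1.1 (1.89) p.33 (kernel version; constant and proof ours)] -/
theorem norm_fdiffEnd_GEnd_le (ν : Fin d) (B : VecField n M) :
    ‖fdiffEnd n M ν (GEnd n M a B)‖ ≤ (gammaZero d a)⁻¹ * ‖B‖ := by
  rw [fdiffEnd_apply, GEnd_apply, WithLp.ofLp_toLp, ← l2R_eq_norm, norm_eq_l2R]
  exact ineq189R_gradG_dir n hn M a ha ν _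

/-- **(1.89), gradient in tensor norm: `(Σ_ν ‖∇_ν GB‖²)^{1/2} ≤ γ₀⁻¹‖B‖`** on `L²(T_η)` (real).
[cite: Balaban1984PropagatorsI, Prop. 1.1 (1.89) p.33 (kernel version; constant and proof ours)] -/
theorem norm_grad_GEnd_le (B : VecField n M) :
    Real.sqrt (∑ ν, ‖fdiffEnd n M ν (GEnd n M a B)‖ ^ 2) ≤ (gammaZero d a)⁻¹ * ‖B‖ := by
  have h := ineq189R_gradG n hn M a ha (WithLp.ofLp B)
  rw [← norm_eq_l2R] at h
  refine le_of_eq_of_le ?_ h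
  rw [l2TR]
  congr 1
  refine Finset.sum_congr rfl fun ν _ => ?_
  rw [fdiffEnd_apply, GEnd_apply, WithLp.ofLp_toLp, ← l2R_eq_norm, l2R,
    Real.sq_sqrt (Finset.sum_nonneg fun i _ => sq_nonneg _)]
  rfl

/-- **(1.90) on `L²(T_η)` (real): `γ₀(‖B‖² + Σ_ν‖∇_ν B‖²) ≤ ⟪Δ_a B, B⟫`.**
[cite: Balaban1984PropagatorsI, Prop. 1.1 (1.90) p.33 (kernel version; constant and proof ours)] -/
theorem inner_DeltaAEnd_ge (B : VecField n M) :
    gammaZero d a * (‖B‖ ^ 2 + ∑ ν, ‖fdiffEnd n M ν B‖ ^ 2)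
      ≤ inner ℝ (DeltaAEnd n M a B) B := by
  have h := ineq190R_form n hn M a ha (WithLp.ofLp B)
  simp only [DeltaAEnd_apply, EuclideanSpace.inner_eq_star_dotProduct, star_trivial]
  refine le_of_eq_of_le ?_ h
  congr 1
  have hL : WithLp.ofLp B ⬝ᵥ ((LapR n M + 1) *ᵥ WithLp.ofLp B)
      = ∑ ν, ‖fdiffEnd n M ν B‖ ^ 2 + ‖B‖ ^ 2 := by
    rw [Matrix.add_mulVec, Matrix.one_mulVec, dotProduct_add]
    congr 1
    · rw [LapR, Lap]
      have hre : reM (∑ ν, (fdiff (fine n M) (n : ℂ) ν)ᴴ * fdiff (fine n M) (n : ℂ) ν)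
          = ∑ ν, (fdiffR n M ν)ᵀ * fdiffR n M ν := by
        ext i j
        simp only [reM_apply, Matrix.sum_apply, Complex.re_sum]
        refine Finset.sum_congr rfl fun ν _ => ?_
        have h1 := congrFun (congrFun ((isReal_fdiff (fine n M) (map_natCast conj n)
          ν).conjTranspose.reM_mul (isReal_fdiff (fine n M) (map_natCast conj n) ν)) i) j
        rw [reM_apply] at h1
        rw [h1, reM_conjTranspose]
        rfl
      rw [hre, Matrix.sum_mulVec, dotProduct_sum]
      refine Finset.sum_congr rfl fun ν _ => ?_
      rw [← Matrix.mulVec_mulVec, Matrix.dotProduct_mulVec, ← Matrix.mulVec_transpose,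
        Matrix.transpose_transpose, fdiffEnd_apply, ← l2R_eq_norm, l2R,
        Real.sq_sqrt (Finset.sum_nonneg fun i _ => sq_nonneg _)]
      simp only [dotProduct, pow_two]
    · rw [norm_eq_l2R, l2R, Real.sq_sqrt (Finset.sum_nonneg fun i _ => sq_nonneg _)]
      simp only [dotProduct, pow_two]
  rw [hL, add_comm]

end Euclidean

end

end Literature.MathematicalPhysics.QuantumFieldTheory.Balaban1983to89.B5RealFields
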